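import Summits.QuantumFields.YangMills.Theorems.BalabanUVNodesK0AxJoinTLeaves

/-!
# LANDING NOTE (porter PTC-1 g3, 2026-08-31; AUTHORSHIP = ◇ lens-1 g9, HOME sketch `nodeO-cover/LENS-1g9-JoinT-v1.1.lean` sha16 12ba32c4290d3909; ★★★ director-ym №527 (b)).
# THIS FILE `…K0AxJoinT.lean` = the sketch's §C (★★ `abs_polComp_succ_sub_polComp_le_of_rows` — the two-volume step per colour from the rows), §D (★★★
# `twoVol_pvolOf_of_rows_trace` — the same in trace form, the currency of [E] `K0AxTwoVolumeRate.RecordPvolTwoVolExpOnRunsAx`); ◆ CRIT-1 g36 CUT 08:12:53Z: PASS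
# (J1′ ∕ J5′ ∕ axioms standard).  Companions: ✓`…K0AxJoinTLeaves.lean` (§A + §B, same namespace `…Theorems.K0AxJoinT`, whose module docstring states the whole clause and its
# honest framing) and `…K0AxJoinTRecord.lean` (§E, bookkeeping at the record).  §K
# (`kstep_joinT_at_record`, the ONE declared `sorry` of the sketch) is NOT landed.  CONDITIONAL theorems over DISPLAYED row predicates (all hypotheses) + generic folklore;
# nothing of Bałaban asserted, ported, discharged or refuted; [E] inhabited nowhere; K0ᴬ stmt-QuantumFields-27238 OPEN; NODE O 0∕1; COUNT 8∕28 · K 1∕4 UNMOVED; finite 𝕋⁴ at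
# fixed ε — NOT continuum ∕ OS ∕ Clay; the Yang–Mills mass gap is NOT proved by any of this.
-/

noncomputable section

open Filter Topology
open scoped BigOperators

namespace Summit.QuantumFields.YangMills.Theorems.K0AxJoinT

open Literature.MathematicalPhysics.QuantumFieldTheory.Balaban1983to89
open Literature.MathematicalPhysics.QuantumFieldTheory.Balaban1983to89.Node00 (TermFamily1 siteOfInt polWindow polScalar betaOfRecord₁₃Ax)
open Literature.MathematicalPhysics.QuantumFieldTheory.Balaban1983to89.T4Continuum (T4Family)
open Literature.MathematicalPhysics.QuantumFieldTheory.Balaban1983to89.B12FormatPlus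
open Literature.MathematicalPhysics.QuantumFieldTheory.Balaban1983to89.B12Decay510 (SiteGeometry GeomLeaf CubeSumLeaf TreeLeaf KernelBound delta1 mixedDeriv
  sum_abs_le delta1_le_half delta1_mul_le delta1_nonneg)
open Literature.MathematicalPhysics.QuantumFieldTheory.Balaban1983to89.B12Decay510Gauge (norm_mixedDeriv_le_gauge kernelBound_of_gauge)
open Literature.MathematicalPhysics.QuantumFieldTheory.Balaban1983to89.B12Decay510TwoVolume (kernelBound_twoVolume_of_gauge mixedDeriv_nextMember_eq maskKernel
  sum_filter_abs_eq_sum_abs_maskKernel comapLabels abs_sum_next_sub_sum_le_three)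
open Literature.MathematicalPhysics.QuantumFieldTheory.Balaban1983to89.B12Eq435SecondVariation (ofReal_fderiv_fderiv_eq_sum_mixedDeriv_of_repr)
open Literature.MathematicalPhysics.QuantumFieldTheory.Balaban1983to89.Beta.RemainderLocality (mixedDeriv_comp_clm mixedDeriv_eq_fderiv_fderiv
  differentiableAt_fderiv_of_analyticAt)
open Summit.QuantumFields.YangMills.Theorems.K0RecordFormatNames (ΦfOf pvolOf plimOf)
open Summit.QuantumFields.YangMills.Theorems.PortH (exists_cutTo_clm pvolOf_eq_trace)

section Generic

variable (F : T4Family) {𝔄 : Type} [NormedRing 𝔄] [NormedAlgebra ℝ 𝔄] {V : Type} [NormedAddCommGroup V] [NormedSpace ℝ V] {ι : Type} [Fintype ι]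
  (fam : TermFamily1 F 𝔄) (ρ : V →L[ℝ] 𝔄) (bV : Module.Basis ι ℝ V) (k : ℕ) (v : Fin (k + 1) → ℝ)
  {S : ℕ → LocDomainSys} {M m : ℕ → ℕ}

/-! ## §C  ★★ THE TWO-VOLUME STEP, PER COLOUR, FROM THE ROWS -/

/-- The inner-window labels of member `n` (the pairs `(μ, z)` with `2|z_l| < Nin n`). [cite: Balaban1987RG1, (1.21) p.264 (bookkeeping)] -/
abbrev WinLab (Nin : ℕ) : Type := {p : Fin 4 × (Fin 4 → ℤ) // ∀ l, 2 * |p.2 l| < (Nin : ℤ)}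

omit [Fintype ι] in
/-- ★★ **THE TWO-VOLUME STEP FOR `Π^{aa}_{μν}(z, 0)` FROM THE ROWS** (the sibling of ✓`PortH.abs_polComp_diag_le_of_rows`): the (1.19)-mould pieces at one history (Analytic19,
Bound118, Local17, Repr17 at both members, Ward414, PieceVolIndep), the chart on the (4.4) domains, the (A3) cut, the PER-COLOUR rows (R1ᴰ) `hdec`, (R3) `hunwrap`, (R4ᴰ) `hcmp`
on the window `N`, (R5) `hI`, the colour-`a` response link `hL`, injectivity of the embedding off the wrap class, the two LARGE-OR-FAR rows at separation `Rsep n` for the inner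
window `Nin n ≤ N n`, the cube-sum leaf at `δ₀∕4` and the tree leaf at `κ∕4` ⟹ for `z` in the inner window of member `n`:
`|Π^{aa}_{n+1}(μ,z;ν,0) − Π^{aa}_n(μ,z;ν,0)| ≤ 48E₀C₉²K₀K₁·e^{−δ₀N n∕2} + 32E₀C₉²e^{δ₁Mg c₁}K₀K₁·e^{−δ₁Rsep n}`, `δ₁ = delta1 δ₀ κ Mg`.
[cite: Balaban1987RG1, (1.21) p.264, (1.7) p.261, (1.18) p.263, (4.35)–(4.37) pp.290–291, (4.4)–(4.5) pp.281–282, (4.14) p.284; Balaban1985Variational, Prop. 9 p.309] -/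
theorem abs_polComp_succ_sub_polComp_le_of_rows (Uc : (n : ℕ) → (S n).Dom → Set (Fin (M n) → ℂ)) (coords : (n : ℕ) → (S n).Dom → Finset (Fin (M n)))
    (χ : (n : ℕ) → (S n).Dom → (Fin (m n) → ℂ) → (Fin (M n) → ℂ)) (D : (n : ℕ) → (S n).Dom → Set (Fin (m n) → ℂ))
    (E : Pieces S M) (R : Response9Data S M m 4) (K : ℕ → ℕ) (Gc : (n : ℕ) → ι → R.Λ n → (Fin (m n) → ℂ))
    (ιe : (n : ℕ) → (Fin (F.P (K n)).d → Site (F.P (K n)) (k + 1) → V) → (Fin (m n) → ℂ))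
    {E₀ κ C₉ δ₀ Mg c₁ K₀ K₁ : ℝ} {N Nin : ℕ → ℕ} {Rsep : ℕ → ℝ}
    (hE₀ : 0 ≤ E₀) (hκ : 0 ≤ κ) (hC₉ : 0 ≤ C₉) (hδ₀ : 0 ≤ δ₀) (hMg : 0 < Mg) (hK₀ : 0 ≤ K₀)
    (hAn : Analytic19 Uc E) (hB : Bound118 S Uc E E₀ κ) (hLoc : Local17 coords E) (hRep : Repr17 S E χ (fun n => ΦfOf F fam ρ k v (K n)) ιe)
    (hW : Ward414 χ E) (hV : PieceVolIndep S M R.wrap R.emb R.πc E) (hC : Chart44D S M Uc m χ D)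
    (hcut : ∀ n X u, ∀ i ∈ coords n X, χ n X (cutTo (R.cX n X) u) i = χ n X u i)
    (hdec : ∀ n (a : ι) X y, gauge (D n X) (cutTo (R.cX n X) (Gc n a y)) ≤ C₉ * Real.exp (-δ₀ * (R.G n).distD y X))
    (hunwrap : ∀ n X, X ∉ R.wrap n → ∀ i ∈ R.cX n X, R.jX n X i ∈ R.cX (n + 1) (R.emb n X))
    (hcmp : ∀ n (a : ι) X, X ∉ R.wrap n → ∀ (μ : Fin 4) (z : Fin 4 → ℤ), (∀ l, 2 * |z l| < (N n : ℤ)) →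
      gauge (D n X) (cutTo (R.cX n X) fun i => Gc (n + 1) a (R.e (n + 1) μ z) (R.jX n X i) - Gc n a (R.e n μ z) i) ≤
        C₉ * Real.exp (-δ₀ * (N n : ℝ) / 2) * Real.exp (-(δ₀ / 2) * (R.G n).distD (R.e n μ z) X))
    (hI : ∀ n X, X ∉ R.wrap n → ∀ w', R.πc n X (χ (n + 1) (R.emb n X) w') = χ n X (restrictCLM (R.cX n X) (R.jX n X) w'))
    (hinj : ∀ n, Set.InjOn (R.emb n) {X | X ∉ R.wrap n})
    (hNin : ∀ n, Nin n ≤ N n)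
    (hsepW : ∀ n X, X ∈ R.wrap n → ∀ (μ : Fin 4) (z : Fin 4 → ℤ), (∀ l, 2 * |z l| < (Nin n : ℤ)) →
      Rsep n ≤ (R.G n).distD (R.e n μ z) X + Mg * ((S n).dj X + c₁))
    (hsepF : ∀ n (X' : (S (n + 1)).Dom), (∀ X, X ∉ R.wrap n → R.emb n X ≠ X') → ∀ (μ : Fin 4) (z : Fin 4 → ℤ), (∀ l, 2 * |z l| < (Nin n : ℤ)) →
      Rsep n ≤ (R.G (n + 1)).distD (R.e (n + 1) μ z) X' + Mg * ((S (n + 1)).dj X' + c₁))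
    (hcube : ∀ n, CubeSumLeaf (R.G n) (δ₀ / 4) K₁) (htree : ∀ n, TreeLeaf (R.Cc n) (κ / 4) K₀)
    (hL : ∀ n, ιe n 0 = 0 ∧ ContDiffAt ℝ 2 (ιe n) 0 ∧ ∀ (a : ι) (μ : Fin 4) (z : Fin 4 → ℤ),
      Gc n a (R.e n μ z) = fderiv ℝ (ιe n) 0 (Pi.single (Fin.cast (F.P_d (K n)).symm μ) (Pi.single (siteOfInt F (K n) (k + 1) z) (bV a))))
    (n : ℕ) (a : ι) (μ ν : Fin 4) (z : Fin 4 → ℤ) (hz : ∀ l, 2 * |z l| < (Nin n : ℤ)) :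
    |B12PolarizationTensor120.polComp ℝ (B12PolarizationTensor120.expChart (fam k v (K (n + 1))) ρ) bV (Fin.cast (F.P_d (K (n + 1))).symm μ)
        (siteOfInt F (K (n + 1)) (k + 1) z) a (Fin.cast (F.P_d (K (n + 1))).symm ν) (siteOfInt F (K (n + 1)) (k + 1) 0) a -
      B12PolarizationTensor120.polComp ℝ (B12PolarizationTensor120.expChart (fam k v (K n)) ρ) bV (Fin.cast (F.P_d (K n)).symm μ)
        (siteOfInt F (K n) (k + 1) z) a (Fin.cast (F.P_d (K n)).symm ν) (siteOfInt F (K n) (k + 1) 0) a| ≤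
      48 * E₀ * C₉ ^ 2 * K₀ * K₁ * Real.exp (-δ₀ * (N n : ℝ) / 2) +
        32 * E₀ * C₉ ^ 2 * Real.exp (delta1 δ₀ κ Mg * Mg * c₁) * K₀ * K₁ * Real.exp (-(delta1 δ₀ κ Mg) * Rsep n) := by
  classical
  -- (4.37) at both members
  rw [polComp_eq_sum_re_mixedDeriv_dir F fam ρ bV k v Uc coords χ D E R K Gc ιe hAn hLoc hRep hW hC hcut hL (n + 1) a μ ν z,
    polComp_eq_sum_re_mixedDeriv_dir F fam ρ bV k v Uc coords χ D E R K Gc ιe hAn hLoc hRep hW hC hcut hL n a μ ν z]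
  -- abbreviations: the charted pieces, the (4.4) domain facts
  set f : (j : ℕ) → (S j).Dom → (Fin (m j) → ℂ) → ℂ := fun j X u => E j X (χ j X u) with hf
  have hDom : ∀ j (X : (S j).Dom), Convex ℝ (D j X) ∧ Balanced ℂ (D j X) ∧ IsOpen (D j X) ∧ (0 : Fin (m j) → ℂ) ∈ D j X := fun j X => by
    obtain ⟨h1, h2, h3, h4, -, -⟩ := hC j X; exact ⟨h1, h2, h3, h4⟩
  have han : ∀ j (X : (S j).Dom), AnalyticOnNhd ℂ (f j X) (D j X) := fun j X w hw => by
    obtain ⟨-, -, -, -, hχan, hmaps⟩ := hC j X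
    exact (hAn j X (χ j X w) (hmaps hw)).comp (hχan w hw)
  have h118 : ∀ j (X : (S j).Dom), ∀ w ∈ D j X, ‖f j X w‖ ≤ E₀ * Real.exp (-κ * (S j).dj X) := fun j X w hw => by
    obtain ⟨-, -, -, -, -, hmaps⟩ := hC j X
    exact (bound118_iff Uc E E₀ κ).1 hB j X _ (hmaps hw)
  -- the window label data
  have hN0 : 0 < (Nin n : ℤ) := by have := hz 0; have := abs_nonneg (z 0); linarith
  have h0win : ∀ l : Fin 4, 2 * |(0 : Fin 4 → ℤ) l| < (Nin n : ℤ) := fun l => by simpa using hN0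
  let p₀ : WinLab (Nin n) := ⟨(ν, 0), h0win⟩
  let p₁ : WinLab (Nin n) := ⟨(μ, z), hz⟩
  let lab : WinLab (Nin n) → R.Λ n := fun p => R.e n p.1.1 p.1.2
  let lab' : WinLab (Nin n) → R.Λ (n + 1) := fun p => R.e (n + 1) p.1.1 p.1.2
  have hwinN : ∀ p : WinLab (Nin n), ∀ l, 2 * |p.1.2 l| < (N n : ℤ) := fun p l =>
    (p.2 l).trans_le (by exact_mod_cast hNin n)
  -- member n's kernel, member n+1's kernel, and member n+1's kernel PULLED BACK (equal to member n's on the wrap class, where nothing is claimed)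
  let h : (S n).Dom → WinLab (Nin n) → (Fin (m n) → ℂ) := fun X p => cutTo (R.cX n X) (Gc n a (lab p))
  let h' : (S n).Dom → WinLab (Nin n) → (Fin (m n) → ℂ) := fun X p =>
    if X ∈ R.wrap n then h X p else cutTo (R.cX n X) fun i => Gc (n + 1) a (lab' p) (R.jX n X i)
  let Em : (S n).Dom → WinLab (Nin n) → WinLab (Nin n) → ℝ := fun X p q => (mixedDeriv (f n X) (h X p) (h X q)).re
  let Ep : (S n).Dom → WinLab (Nin n) → WinLab (Nin n) → ℝ := fun X p q => (mixedDeriv (f n X) (h' X p) (h' X q)).re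
  let hn : (S (n + 1)).Dom → WinLab (Nin n) → (Fin (m (n + 1)) → ℂ) := fun X' p => cutTo (R.cX (n + 1) X') (Gc (n + 1) a (lab' p))
  let En : (S (n + 1)).Dom → WinLab (Nin n) → WinLab (Nin n) → ℝ := fun X' p q => (mixedDeriv (f (n + 1) X') (hn X' p) (hn X' q)).re
  -- the sums in the goal ARE `Σ En · p₀ p₁` and `Σ Em · p₀ p₁`
  show |∑ X', En X' p₀ p₁ - ∑ X, Em X p₀ p₁| ≤ _
  -- the three-term split
  have hsplit := abs_sum_next_sub_sum_le_three (fun X => Em X p₀ p₁) (fun X' => En X' p₀ p₁) (R.emb n) (fun X => X ∈ R.wrap n) (hinj n)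
  -- (U) the matched part
  have hη : 0 ≤ C₉ * Real.exp (-δ₀ * (N n : ℝ) / 2) := mul_nonneg hC₉ (Real.exp_pos _).le
  have hKB_U : KernelBound (comapLabels (R.G n) lab) (fun X p q => Ep X p q - Em X p q)
      (16 * E₀ * (C₉ * Real.exp (-δ₀ * (N n : ℝ) / 2)) * ((C₉ + C₉ * Real.exp (-δ₀ * (N n : ℝ) / 2)) + C₉)) κ (δ₀ / 2) := by
    refine kernelBound_twoVolume_of_gauge (comapLabels (R.G n) lab) (f n) (D n) h h' Em Ep hE₀ hC₉ hη hδ₀ (hDom n) (han n) (h118 n)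
      (fun _ _ _ => rfl) (fun _ _ _ => rfl) (fun X p => hdec n a X (lab p)) fun X p => ?_
    show gauge (D n X) (h' X p - h X p) ≤ C₉ * Real.exp (-δ₀ * (N n : ℝ) / 2) * Real.exp (-(δ₀ / 2) * (R.G n).distD (lab p) X)
    by_cases hX : X ∈ R.wrap n
    · simp only [h', if_pos hX, sub_self, gauge_zero]
      exact mul_nonneg hη (Real.exp_pos _).le
    · simp only [h', h, if_neg hX, cutTo_sub]
      exact hcmp n a X hX p.1.1 p.1.2 (hwinN p)
  have hU : ∑ X, |Ep X p₀ p₁ - Em X p₀ p₁| ≤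
      16 * E₀ * (C₉ * Real.exp (-δ₀ * (N n : ℝ) / 2)) * ((C₉ + C₉ * Real.exp (-δ₀ * (N n : ℝ) / 2)) + C₉) * K₀ * K₁ :=
    sum_abs_le_const (comapLabels (R.G n) lab) (by positivity) hK₀ hκ (by linarith) hKB_U
      (by simpa [show δ₀ / 2 / 2 = δ₀ / 4 by ring] using cubeSumLeaf_comapLabels (R.G n) lab (hcube n))
      (treeLeaf_of_le (R.Cc n) (by linarith) (htree n)) p₀ p₁
  -- on the good class, member n+1's term at `emb X` IS the pulled-back term
  have hmatch : ∀ X, X ∉ R.wrap n → En (R.emb n X) p₀ p₁ = Ep X p₀ p₁ := by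
    intro X hX
    have hpull : ∀ p, restrictCLM (R.cX n X) (R.jX n X) (hn (R.emb n X) p) = h' X p := fun p => by
      simp only [hn, h', if_neg hX]
      exact restrictCLM_cutTo_of_unwrap _ _ _ (hunwrap n X hX) _
    simp only [En, Ep]
    rw [mixedDeriv_nextMember_eq (E n X) (E (n + 1) (R.emb n X)) (χ n X) (χ (n + 1) (R.emb n X)) (R.πc n X)
      (restrictCLM (R.cX n X) (R.jX n X)) (hV n X hX) (hI n X hX) (hDom n X).2.2.1 (hDom n X).2.2.2 (han n X), hpull, hpull]
  have hUsum : ∑ X ∈ Finset.univ.filter (fun X => ¬X ∈ R.wrap n), |En (R.emb n X) p₀ p₁ - Em X p₀ p₁| ≤ ∑ X, |Ep X p₀ p₁ - Em X p₀ p₁| := by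
    calc ∑ X ∈ Finset.univ.filter (fun X => ¬X ∈ R.wrap n), |En (R.emb n X) p₀ p₁ - Em X p₀ p₁|
        = ∑ X ∈ Finset.univ.filter (fun X => ¬X ∈ R.wrap n), |Ep X p₀ p₁ - Em X p₀ p₁| :=
          Finset.sum_congr rfl fun X hX => by rw [hmatch X (Finset.mem_filter.1 hX).2]
      _ ≤ ∑ X, |Ep X p₀ p₁ - Em X p₀ p₁| :=
          Finset.sum_le_sum_of_subset_of_nonneg (Finset.filter_subset _ _) fun _ _ _ => abs_nonneg _
  -- (W₁) member n's wrap-class tail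
  have hδ₁ := delta1_nonneg hδ₀ hκ hMg
  have hδ₁h := delta1_le_half δ₀ κ Mg
  have hδ₁M := delta1_mul_le δ₀ κ hMg
  have hKB_n : KernelBound (comapLabels (R.G n) lab) Em (16 * E₀ * C₉ ^ 2) κ δ₀ :=
    kernelBound_of_gauge (comapLabels (R.G n) lab) (f n) (D n) h Em hC₉ (hDom n) (han n) (h118 n) (fun _ _ _ => rfl) fun X p => hdec n a X (lab p)
  have hKB_W1 := kernelBound_maskKernel_of_largeOrFar (comapLabels (R.G n) lab) (Rsep := Rsep n) (by positivity) hδ₁ hδ₁h hδ₁M hKB_n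
    (fun X => X ∈ R.wrap n) fun X hX p => hsepW n X hX p.1.1 p.1.2 p.2
  have hW1 : ∑ X ∈ Finset.univ.filter (fun X => X ∈ R.wrap n), |Em X p₀ p₁| ≤
      16 * E₀ * C₉ ^ 2 * Real.exp (delta1 δ₀ κ Mg * Mg * c₁) * Real.exp (-(delta1 δ₀ κ Mg) * Rsep n) * K₀ * K₁ := by
    rw [sum_filter_abs_eq_sum_abs_maskKernel]
    exact sum_abs_le_const (comapLabels (R.G n) lab) (by positivity) hK₀ (by linarith) (by linarith) hKB_W1
      (by simpa [show δ₀ / 2 / 2 = δ₀ / 4 by ring] using cubeSumLeaf_comapLabels (R.G n) lab (hcube n))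
      (by simpa [show κ / 2 / 2 = κ / 4 by ring] using htree n) p₀ p₁
  -- (W₂) member n+1's non-image tail
  have hKB_n1 : KernelBound (comapLabels (R.G (n + 1)) lab') En (16 * E₀ * C₉ ^ 2) κ δ₀ :=
    kernelBound_of_gauge (comapLabels (R.G (n + 1)) lab') (f (n + 1)) (D (n + 1)) hn En hC₉ (hDom (n + 1)) (han (n + 1)) (h118 (n + 1))
      (fun _ _ _ => rfl) fun X' p => hdec (n + 1) a X' (lab' p)
  set img := (Finset.univ.filter (fun X => ¬X ∈ R.wrap n)).image (R.emb n) with himg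
  have hfar : ∀ X' : (S (n + 1)).Dom, X' ∉ img → ∀ p : WinLab (Nin n),
      Rsep n ≤ (comapLabels (R.G (n + 1)) lab').distD p X' + Mg * ((S (n + 1)).dj X' + c₁) := by
    intro X' hX' p
    refine hsepF n X' (fun X hX hXe => hX' ?_) p.1.1 p.1.2 p.2
    exact Finset.mem_image.2 ⟨X, Finset.mem_filter.2 ⟨Finset.mem_univ _, hX⟩, hXe⟩
  have hKB_W2 := kernelBound_maskKernel_of_largeOrFar (comapLabels (R.G (n + 1)) lab') (Rsep := Rsep n) (by positivity) hδ₁ hδ₁h hδ₁M hKB_n1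
    (fun X' => X' ∉ img) hfar
  have hW2 : ∑ X' ∈ Finset.univ.filter (fun X' => X' ∉ img), |En X' p₀ p₁| ≤
      16 * E₀ * C₉ ^ 2 * Real.exp (delta1 δ₀ κ Mg * Mg * c₁) * Real.exp (-(delta1 δ₀ κ Mg) * Rsep n) * K₀ * K₁ := by
    rw [sum_filter_abs_eq_sum_abs_maskKernel]
    exact sum_abs_le_const (comapLabels (R.G (n + 1)) lab') (by positivity) hK₀ (by linarith) (by linarith) hKB_W2
      (by simpa [show δ₀ / 2 / 2 = δ₀ / 4 by ring] using cubeSumLeaf_comapLabels (R.G (n + 1)) lab' (hcube (n + 1)))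
      (by simpa [show κ / 2 / 2 = κ / 4 by ring] using htree (n + 1)) p₀ p₁
  -- constants: η ≤ C₉
  have hηC : C₉ * Real.exp (-δ₀ * (N n : ℝ) / 2) ≤ C₉ := by
    have : Real.exp (-δ₀ * (N n : ℝ) / 2) ≤ 1 := Real.exp_le_one_iff.2 (by
      have : (0 : ℝ) ≤ N n := Nat.cast_nonneg _
      nlinarith)
    simpa using mul_le_mul_of_nonneg_left this hC₉
  have hUconst : 16 * E₀ * (C₉ * Real.exp (-δ₀ * (N n : ℝ) / 2)) * ((C₉ + C₉ * Real.exp (-δ₀ * (N n : ℝ) / 2)) + C₉) * K₀ * K₁ ≤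
      48 * E₀ * C₉ ^ 2 * K₀ * K₁ * Real.exp (-δ₀ * (N n : ℝ) / 2) := by
    have hK₁ : 0 ≤ K₁ := (Finset.sum_nonneg fun c _ => (Real.exp_pos _).le).trans (hcube n (R.e n ν 0))
    have h3 : (C₉ + C₉ * Real.exp (-δ₀ * (N n : ℝ) / 2)) + C₉ ≤ 3 * C₉ := by linarith
    have hpos : 0 ≤ 16 * E₀ * (C₉ * Real.exp (-δ₀ * (N n : ℝ) / 2)) := by positivity
    calc 16 * E₀ * (C₉ * Real.exp (-δ₀ * (N n : ℝ) / 2)) * ((C₉ + C₉ * Real.exp (-δ₀ * (N n : ℝ) / 2)) + C₉) * K₀ * K₁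
        ≤ 16 * E₀ * (C₉ * Real.exp (-δ₀ * (N n : ℝ) / 2)) * (3 * C₉) * K₀ * K₁ := by
          have := mul_le_mul_of_nonneg_left h3 hpos
          exact mul_le_mul_of_nonneg_right (mul_le_mul_of_nonneg_right this hK₀) hK₁
      _ = 48 * E₀ * C₉ ^ 2 * K₀ * K₁ * Real.exp (-δ₀ * (N n : ℝ) / 2) := by ring
  -- assemble
  calc |∑ X', En X' p₀ p₁ - ∑ X, Em X p₀ p₁|
      ≤ (∑ X ∈ Finset.univ.filter (fun X => ¬X ∈ R.wrap n), |En (R.emb n X) p₀ p₁ - Em X p₀ p₁|) +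
          (∑ X ∈ Finset.univ.filter (fun X => X ∈ R.wrap n), |Em X p₀ p₁|) + ∑ X' ∈ Finset.univ.filter (fun X' => X' ∉ img), |En X' p₀ p₁| := hsplit
    _ ≤ 48 * E₀ * C₉ ^ 2 * K₀ * K₁ * Real.exp (-δ₀ * (N n : ℝ) / 2) +
          16 * E₀ * C₉ ^ 2 * Real.exp (delta1 δ₀ κ Mg * Mg * c₁) * Real.exp (-(delta1 δ₀ κ Mg) * Rsep n) * K₀ * K₁ +
          16 * E₀ * C₉ ^ 2 * Real.exp (delta1 δ₀ κ Mg * Mg * c₁) * Real.exp (-(delta1 δ₀ κ Mg) * Rsep n) * K₀ * K₁ :=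
        add_le_add (add_le_add (hUsum.trans (hU.trans hUconst)) hW1) hW2
    _ = _ := by ring

/-! ## §D  ★★★ THE TWO-VOLUME STEP FOR THE TRACE KERNEL `pvolOf` (the currency of [E]) -/

/-- ★★★ **THE TWO-VOLUME ROAD IN TRACE FORM** (sibling of ✓`PortH.decay510_plimOf_of_rows_trace`, same hypothesis style; `FormatPlusG` → `Ward414` by
✓`ward414_of_gaugeInv119_chart44D`): for `z` in the inner window of member `n`,
`|pvolOf (K (n+1)) μ ν z − pvolOf (K n) μ ν z| ≤ 48E₀C₉²K₀K₁·e^{−δ₀N n∕2} + 32E₀C₉²e^{δ₁Mg c₁}K₀K₁·e^{−δ₁Rsep n}` — the average of `card ι` identical per-colour bounds.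
[cite: Balaban1987RG1, (1.21) p.264, (1.7) p.261, (1.18)–(1.19) p.263, (4.35)–(4.37) pp.290–291, (4.4)–(4.5) pp.281–282, (4.14) p.284; Balaban1985Variational, Prop. 9 p.309] -/
theorem twoVol_pvolOf_of_rows_trace [DecidableEq ι] (Uc : (n : ℕ) → (S n).Dom → Set (Fin (M n) → ℂ)) (coords : (n : ℕ) → (S n).Dom → Finset (Fin (M n)))
    (χ : (n : ℕ) → (S n).Dom → (Fin (m n) → ℂ) → (Fin (M n) → ℂ)) (D : (n : ℕ) → (S n).Dom → Set (Fin (m n) → ℂ))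
    {Gg : ℕ → Type*} (act : (n : ℕ) → Gg n → (Fin (M n) → ℂ) → (Fin (M n) → ℂ)) {Hg : ℕ → Type*} (toG : (n : ℕ) → Hg n → Gg n)
    (A : (n : ℕ) → Hg n → ((Fin (m n) → ℂ) →L[ℂ] (Fin (m n) → ℂ))) (R : Response9Data S M m 4) (K : ℕ → ℕ)
    (Gc : (n : ℕ) → ι → R.Λ n → (Fin (m n) → ℂ))
    (ιe : (n : ℕ) → (Fin (F.P (K n)).d → Site (F.P (K n)) (k + 1) → V) → (Fin (m n) → ℂ))
    {E₀ κ C₉ δ₀ Mg c₁ K₀ K₁ : ℝ} {N Nin : ℕ → ℕ} {Rsep : ℕ → ℝ}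
    (hE₀ : 0 ≤ E₀) (hκ : 0 ≤ κ) (hC₉ : 0 ≤ C₉) (hδ₀ : 0 ≤ δ₀) (hMg : 0 < Mg) (hK₀ : 0 ≤ K₀)
    (hA : FormatPlusG S M act Uc coords m χ (fun n => ΦfOf F fam ρ k v (K n)) ιe R.wrap R.emb R.πc E₀ κ)
    (hC : Chart44D S M Uc m χ D) (hEq : ChartEquivariant toG act χ A) (hNI : ∀ n, NoInvariantCovector (A n))
    (hcut : ∀ n X u, ∀ i ∈ coords n X, χ n X (cutTo (R.cX n X) u) i = χ n X u i)
    (hdec : ∀ n (a : ι) X y, gauge (D n X) (cutTo (R.cX n X) (Gc n a y)) ≤ C₉ * Real.exp (-δ₀ * (R.G n).distD y X))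
    (hunwrap : ∀ n X, X ∉ R.wrap n → ∀ i ∈ R.cX n X, R.jX n X i ∈ R.cX (n + 1) (R.emb n X))
    (hcmp : ∀ n (a : ι) X, X ∉ R.wrap n → ∀ (μ : Fin 4) (z : Fin 4 → ℤ), (∀ l, 2 * |z l| < (N n : ℤ)) →
      gauge (D n X) (cutTo (R.cX n X) fun i => Gc (n + 1) a (R.e (n + 1) μ z) (R.jX n X i) - Gc n a (R.e n μ z) i) ≤
        C₉ * Real.exp (-δ₀ * (N n : ℝ) / 2) * Real.exp (-(δ₀ / 2) * (R.G n).distD (R.e n μ z) X))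
    (hI : ∀ n X, X ∉ R.wrap n → ∀ w', R.πc n X (χ (n + 1) (R.emb n X) w') = χ n X (restrictCLM (R.cX n X) (R.jX n X) w'))
    (hinj : ∀ n, Set.InjOn (R.emb n) {X | X ∉ R.wrap n})
    (hNin : ∀ n, Nin n ≤ N n)
    (hsepW : ∀ n X, X ∈ R.wrap n → ∀ (μ : Fin 4) (z : Fin 4 → ℤ), (∀ l, 2 * |z l| < (Nin n : ℤ)) →
      Rsep n ≤ (R.G n).distD (R.e n μ z) X + Mg * ((S n).dj X + c₁))
    (hsepF : ∀ n (X' : (S (n + 1)).Dom), (∀ X, X ∉ R.wrap n → R.emb n X ≠ X') → ∀ (μ : Fin 4) (z : Fin 4 → ℤ), (∀ l, 2 * |z l| < (Nin n : ℤ)) →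
      Rsep n ≤ (R.G (n + 1)).distD (R.e (n + 1) μ z) X' + Mg * ((S (n + 1)).dj X' + c₁))
    (hcube : ∀ n, CubeSumLeaf (R.G n) (δ₀ / 4) K₁) (htree : ∀ n, TreeLeaf (R.Cc n) (κ / 4) K₀)
    (hL : ∀ n, ιe n 0 = 0 ∧ ContDiffAt ℝ 2 (ιe n) 0 ∧ ∀ (a : ι) (μ : Fin 4) (z : Fin 4 → ℤ),
      Gc n a (R.e n μ z) = fderiv ℝ (ιe n) 0 (Pi.single (Fin.cast (F.P_d (K n)).symm μ) (Pi.single (siteOfInt F (K n) (k + 1) z) (bV a))))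
    (n : ℕ) (μ ν : Fin 4) (z : Fin 4 → ℤ) (hz : ∀ l, 2 * |z l| < (Nin n : ℤ)) :
    |pvolOf F fam ρ bV k v (K (n + 1)) μ ν z - pvolOf F fam ρ bV k v (K n) μ ν z| ≤
      48 * E₀ * C₉ ^ 2 * K₀ * K₁ * Real.exp (-δ₀ * (N n : ℝ) / 2) +
        32 * E₀ * C₉ ^ 2 * Real.exp (delta1 δ₀ κ Mg * Mg * c₁) * K₀ * K₁ * Real.exp (-(delta1 δ₀ κ Mg) * Rsep n) := by
  obtain ⟨E, hAn, hB, hLoc, hRep, hV, hG⟩ := hA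
  have hW : Ward414 χ E := BalabanUVNodesPortS1.ward414_of_gaugeInv119_chart44D hG hEq hC hAn hNI
  set Cz : ℝ := 48 * E₀ * C₉ ^ 2 * K₀ * K₁ * Real.exp (-δ₀ * (N n : ℝ) / 2) +
    32 * E₀ * C₉ ^ 2 * Real.exp (delta1 δ₀ κ Mg * Mg * c₁) * K₀ * K₁ * Real.exp (-(delta1 δ₀ κ Mg) * Rsep n) with hCz
  have hcol : ∀ a : ι, |B12PolarizationTensor120.polComp ℝ (B12PolarizationTensor120.expChart (fam k v (K (n + 1))) ρ) bV (Fin.cast (F.P_d (K (n + 1))).symm μ)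
        (siteOfInt F (K (n + 1)) (k + 1) z) a (Fin.cast (F.P_d (K (n + 1))).symm ν) (siteOfInt F (K (n + 1)) (k + 1) 0) a -
      B12PolarizationTensor120.polComp ℝ (B12PolarizationTensor120.expChart (fam k v (K n)) ρ) bV (Fin.cast (F.P_d (K n)).symm μ)
        (siteOfInt F (K n) (k + 1) z) a (Fin.cast (F.P_d (K n)).symm ν) (siteOfInt F (K n) (k + 1) 0) a| ≤ Cz := fun a =>
    abs_polComp_succ_sub_polComp_le_of_rows F fam ρ bV k v Uc coords χ D E R K Gc ιe hE₀ hκ hC₉ hδ₀ hMg hK₀ hAn hB hLoc hRep hW hV hC hcut hdec hunwrap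
      hcmp hI hinj hNin hsepW hsepF hcube htree hL n a μ ν z hz
  rw [pvolOf_eq_trace, pvolOf_eq_trace, ← mul_sub, ← Finset.sum_sub_distrib, abs_mul, abs_inv, Nat.abs_cast]
  have hK₁ : 0 ≤ K₁ := (Finset.sum_nonneg fun c _ => (Real.exp_pos _).le).trans (hcube n (R.e n ν 0))
  have hCz0 : 0 ≤ Cz := by rw [hCz]; positivity
  have hsum : |∑ a : ι, (B12PolarizationTensor120.polComp ℝ (B12PolarizationTensor120.expChart (fam k v (K (n + 1))) ρ) bV (Fin.cast (F.P_d (K (n + 1))).symm μ)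
        (siteOfInt F (K (n + 1)) (k + 1) z) a (Fin.cast (F.P_d (K (n + 1))).symm ν) (siteOfInt F (K (n + 1)) (k + 1) 0) a -
      B12PolarizationTensor120.polComp ℝ (B12PolarizationTensor120.expChart (fam k v (K n)) ρ) bV (Fin.cast (F.P_d (K n)).symm μ)
        (siteOfInt F (K n) (k + 1) z) a (Fin.cast (F.P_d (K n)).symm ν) (siteOfInt F (K n) (k + 1) 0) a)| ≤ (Fintype.card ι : ℝ) * Cz :=
    (Finset.abs_sum_le_sum_abs _ _).trans <| by
      calc _ ≤ ∑ _a : ι, Cz := Finset.sum_le_sum fun a _ => hcol a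
        _ = (Fintype.card ι : ℝ) * Cz := by rw [Finset.sum_const, Finset.card_univ, nsmul_eq_mul]
  rcases Nat.eq_zero_or_pos (Fintype.card ι) with h0 | hpos
  · rw [h0, Nat.cast_zero, inv_zero, zero_mul]; exact hCz0
  · have hcard : (0 : ℝ) < Fintype.card ι := Nat.cast_pos.2 hpos
    calc (Fintype.card ι : ℝ)⁻¹ * |∑ a : ι, _| ≤ (Fintype.card ι : ℝ)⁻¹ * ((Fintype.card ι : ℝ) * Cz) :=
          mul_le_mul_of_nonneg_left hsum (inv_nonneg.2 hcard.le)
      _ = Cz := by field_simp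

end Generic

end Summit.QuantumFields.YangMills.Theorems.K0AxJoinT

end
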